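import HarnessLib
import Summits.RiemannHypothesis.RiemannHypothesis.Theorems.SignConePointwiseCheckerFastSound

/-!
# Route SignCone: a FAR-RANGE checker for pointwise certificates (comb-only second-order cells)

Support for the single-window rungs of `OscSingleWindow` (crux stmt-RiemannHypothesis-18012), whose
erasure certificates (`SignConeOscSingleWindowPWCertificate.lean`) carry a unit comb of total mass
`Σ a_n ≈ 9–10` and must therefore be checked up to `Y₀ ≍ 3·10⁴` — far beyond the reach of the
Lipschitz cells of `SignConePointwiseCheckerDefs/Fast.lean`. Far from the origin the kernel transform is
negligible (`|Ê_χ(y)| ≤ decayConst/(¼ + y²)`), so the density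
`F_D(y) = Re ψ(1/4+iy/2) − log π + s + Ê_χ(y) − C(y)`, `C(y) = Σ_n a_n cos(y log n)`, is bounded
below on a whole cell around a point `u` from ONE evaluation of the comb and of its derivative:

* `Real.cos_add_le_taylor` : `cos(θ + φ) ≤ cos θ − φ sin θ + φ²/2` (all `θ, φ`), hence
  `C(y) ≤ C(u) + (y − u) C′(u) + (y − u)² S₂/2`, `S₂ = Σ a_n log² n` (`PWData.comb_taylor`);
* `PWData.farEval` : enclosures of `C(u)`, `C′(u)` from the logarithm table (`PW.combCS`);
* `PWData.farMarch` : a self-marching cover — from the frontier `e` it evaluates at `u = e + γ`,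
  certifies the backward piece `[e, u]` and a forward piece `[u, u + δ]` (`δ` from a fixed menu), or
  falls back to a forward piece from `e`; `PWData.farChainOK` runs it segment by segment with a
  fresh digamma anchor `wLoQ` at each breakpoint;
* the elementary inequalities `PWData.comb_taylor`, `PWData.quad_nonneg_of_endpoints`.

Everything is a total computable function on `ℚ`/`ℤ`; the soundness theorems (`farMarch_sound`,
`farChainOK_sound`, `PWData.F_nonneg_of_near_far`) are in `SignConePointwiseCheckerFarSound.lean`. The
Booleans are meant to be evaluated by `native_decide` in certificate files (declared computational).
-/

noncomputable section

-- `Summit.RiemannHypothesis.RiemannHypothesis.…` repeats a namespace component by design (D-0017 layout).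
set_option linter.dupNamespace false

open Real

/-- **Second-order cosine bound**: `cos(θ + φ) ≤ cos θ − φ sin θ + φ²/2` for all real `θ, φ`
(the function `φ ↦ RHS − LHS` vanishes at `0` and has derivative `φ + sin(θ+φ) − sin θ`, of the
sign of `φ` since `sin` is `1`-Lipschitz). [folklore] -/
theorem Real.cos_add_le_taylor (θ φ : ℝ) :
    Real.cos (θ + φ) ≤ Real.cos θ - φ * Real.sin θ + φ ^ 2 / 2 := by
  set f : ℝ → ℝ := fun φ => Real.cos θ - φ * Real.sin θ + φ ^ 2 / 2 - Real.cos (θ + φ) with hf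
  have hd : ∀ φ, HasDerivAt f (φ + Real.sin (θ + φ) - Real.sin θ) φ := by
    intro φ
    have h1 : HasDerivAt (fun φ : ℝ => φ * Real.sin θ) (1 * Real.sin θ) φ :=
      (hasDerivAt_id φ).mul_const _
    have h2 : HasDerivAt (fun φ : ℝ => φ ^ 2 / 2) ((2 : ℕ) * φ ^ (2 - 1) * 1 / 2) φ :=
      ((hasDerivAt_id φ).pow 2).div_const 2
    have h3 : HasDerivAt (fun φ : ℝ => Real.cos (θ + φ)) (-Real.sin (θ + φ) * 1) φ :=
      (Real.hasDerivAt_cos (θ + φ)).comp φ ((hasDerivAt_id φ).const_add θ)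
    have h := (((hasDerivAt_const φ (Real.cos θ)).sub h1).add h2).sub h3
    refine h.congr_deriv ?_
    push_cast
    ring
  have hcont : Continuous f := by rw [hf]; fun_prop
  have hderiv : ∀ φ, deriv f φ = φ + Real.sin (θ + φ) - Real.sin θ := fun φ => (hd φ).deriv
  have hdiff : Differentiable ℝ f := fun φ => (hd φ).differentiableAt
  have hf0 : f 0 = 0 := by simp [hf]
  have key : 0 ≤ f φ := by
    rcases le_or_gt 0 φ with hφ | hφ
    · have hmono : MonotoneOn f (Set.Ici 0) := by
        refine monotoneOn_of_deriv_nonneg (convex_Ici 0) hcont.continuousOn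
          (hdiff.differentiableOn) fun x hx => ?_
        rw [interior_Ici] at hx
        rw [hderiv]
        have := Real.abs_sin_sub_sin_le (θ + x) θ
        rw [abs_le] at this
        have hx' : |θ + x - θ| = x := by rw [add_sub_cancel_left, abs_of_pos hx]
        linarith [this.1]
      have := hmono (Set.mem_Ici.2 le_rfl) (Set.mem_Ici.2 hφ) hφ
      rwa [hf0] at this
    · have hanti : AntitoneOn f (Set.Iic 0) := by
        refine antitoneOn_of_deriv_nonpos (convex_Iic 0) hcont.continuousOn
          (hdiff.differentiableOn) fun x hx => ?_
        rw [interior_Iic] at hx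
        rw [hderiv]
        have := Real.abs_sin_sub_sin_le (θ + x) θ
        rw [abs_le] at this
        have hx' : |θ + x - θ| = -x := by rw [add_sub_cancel_left, abs_of_neg hx]
        linarith [this.2]
      have := hanti (Set.mem_Iic.2 hφ.le) (Set.mem_Iic.2 le_rfl) hφ.le
      rwa [hf0] at this
  rw [hf] at key
  simp only at key
  linarith

namespace Summit.RiemannHypothesis.RiemannHypothesis.Theorems.SignCone

open Literature.Analysis.ValidatedNumerics.Numerics Literature.NumberTheory.LFunctions
open Literature.Analysis.SpecialFunctions (reDigammaQuarter reDigammaQuarter_mono reDigammaQuarter_even)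

namespace PW

/-- Enclosures of the comb and of `Σ a_n log n · sin(u log n)` at `u` from a logarithm table:
`(C(u), Σ a_n log n sin(u log n))` — one `cosSin` call per node. [folklore] -/
def combCS (l : List ℕ) (a : ℕ → ℚ) (logs : List FI) (u : ℚ) : FI × FI :=
  l.foldr (fun n acc =>
    (((FI.ofRat (a n)).mul (FI.cosSin ((FI.ofRat u).mul (logs.getD n (FI.ofInt 0)))).1).add acc.1,
      (((FI.ofRat (a n)).mul (logs.getD n (FI.ofInt 0))).mul
        (FI.cosSin ((FI.ofRat u).mul (logs.getD n (FI.ofInt 0)))).2).add acc.2))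
    (FI.ofInt 0, FI.ofInt 0)

/-- **Soundness of `combCS`** (genuine table, all `n ≤ N`). [folklore] -/
theorem mem_combCS {l : List ℕ} {a : ℕ → ℚ} {N : ℕ} (hok : FI.logTableOK N = true)
    (hl : ∀ n ∈ l, n ≤ N) (u : ℚ) :
    FI.mem (l.map (fun n => (a n : ℝ) * Real.cos ((u : ℝ) * Real.log n))).sum (combCS l a (FI.logTable N) u).1 ∧
      FI.mem (l.map (fun n => (a n : ℝ) * Real.log n * Real.sin ((u : ℝ) * Real.log n))).sum
        (combCS l a (FI.logTable N) u).2 := by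
  induction l with
  | nil => exact ⟨by simpa [combCS] using FI.mem_ofInt 0, by simpa [combCS] using FI.mem_ofInt 0⟩
  | cons n t ih =>
    have hn : n ≤ N := hl n (by simp)
    have ht : ∀ m ∈ t, m ≤ N := fun m hm => hl m (by simp [hm])
    obtain ⟨ih1, ih2⟩ := ih ht
    rw [List.map_cons, List.sum_cons, List.map_cons, List.sum_cons]
    have hθ := FI.mem_mul (FI.mem_ofRat u) (FI.mem_logTable hok hn)
    have hcs := FI.mem_cosSin hθ
    exact ⟨FI.mem_add (FI.mem_mul (FI.mem_ofRat (a n)) hcs.1) ih1,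
      FI.mem_add (FI.mem_mul (FI.mem_mul (FI.mem_ofRat (a n)) (FI.mem_logTable hok hn)) hcs.2) ih2⟩

/-- Upper bound `Σ a_n (log n)⁺²` of `S₂ = Σ a_n log² n` from the table. [folklore] -/
def combS2Q (l : List ℕ) (a : ℕ → ℚ) (logs : List FI) : ℚ :=
  (l.map fun n => a n * ((logs.getD n (FI.ofInt 0)).hiQ * (logs.getD n (FI.ofInt 0)).hiQ)).sum

/-- `Σ a_n log² n ≤ combS2Q` (genuine table, `a_n ≥ 0`, `1 ≤ n ≤ N`). [folklore] -/
theorem sum_mul_log_sq_le_combS2Q {a : ℕ → ℚ} {N : ℕ} (hok : FI.logTableOK N = true) :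
    ∀ l : List ℕ, (∀ n ∈ l, 0 ≤ a n ∧ n ≤ N ∧ 1 ≤ n) →
      (l.map fun n => (a n : ℝ) * Real.log n ^ 2).sum ≤ (combS2Q l a (FI.logTable N) : ℝ)
  | [], _ => by simp [combS2Q]
  | n :: t, hl => by
    have hn := hl n (by simp)
    have ht : ∀ m ∈ t, 0 ≤ a m ∧ m ≤ N ∧ 1 ≤ m := fun m hm => hl m (by simp [hm])
    have ih := sum_mul_log_sq_le_combS2Q hok t ht
    unfold combS2Q at ih ⊢
    rw [List.map_cons, List.sum_cons, List.map_cons, List.sum_cons, Rat.cast_add]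
    have hlog0 : 0 ≤ Real.log n := Real.log_nonneg (by exact_mod_cast hn.2.2)
    have hhi : Real.log n ≤ (((FI.logTable N).getD n (FI.ofInt 0)).hiQ : ℝ) :=
      FI.le_hiQ (FI.mem_logTable hok hn.2.1)
    have ha : (0 : ℝ) ≤ a n := by exact_mod_cast hn.1
    have hsq : Real.log n ^ 2 ≤ (((FI.logTable N).getD n (FI.ofInt 0)).hiQ : ℝ) *
        ((FI.logTable N).getD n (FI.ofInt 0)).hiQ := by
      rw [sq]; exact mul_le_mul hhi hhi hlog0 (hlog0.trans hhi)
    have hcast : ((a n * (((FI.logTable N).getD n (FI.ofInt 0)).hiQ * ((FI.logTable N).getD n (FI.ofInt 0)).hiQ) : ℚ) : ℝ) =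
        (a n : ℝ) * ((((FI.logTable N).getD n (FI.ofInt 0)).hiQ : ℝ) * ((FI.logTable N).getD n (FI.ofInt 0)).hiQ) := by
      push_cast; ring
    rw [hcast]
    have := mul_le_mul_of_nonneg_left hsq ha
    exact add_le_add this ih

end PW

namespace PWData

section Defs

variable (D : PWData)

/-- The per-segment constant `B = w − (log π)⁺ + s − decayHi/(¼ + e₀²)` (digamma anchor `w` at the
breakpoint `e₀`; kernel transform bounded by its decay beyond `e₀`). [folklore] -/
def farB (w e0 : ℚ) : ℚ := w - logPiHi + D.s - D.decayFI.hiQ / (1 / 4 + e0 * e0)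

/-- Evaluation at `u`: `(f, c₁⁻, c₁⁺)` with `f = B − C⁺(u)` and `c₁⁻ ≤ C′(u) ≤ c₁⁺`,
`C′(u) = −Σ a_n log n sin(u log n)`. [folklore] -/
def farEval (logs : List FI) (B u : ℚ) : ℚ × ℚ × ℚ :=
  ((B - (PW.combCS D.nodeList D.a logs u).1.hiQ), -(PW.combCS D.nodeList D.a logs u).2.hiQ,
    -(PW.combCS D.nodeList D.a logs u).2.loQ)

/-- The menu of forward widths. [folklore] -/
def farWidths : List ℚ :=
  [1, 4/5, 13/20, 1/2, 2/5, 3/10, 1/4, 1/5, 3/20, 1/10, 7/100, 1/20, 3/100, 1/50, 1/100, 1/200, 1/500]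

/-- Forward width: the first `δ` of the menu with `f − δ c₁⁺ − δ² S₂/2 ≥ 0`. [folklore] -/
def farPick (S2 f c1hi : ℚ) : Option ℚ :=
  farWidths.find? fun δ => decide (0 ≤ f - δ * c1hi - δ * δ * S2 / 2)

/-- **The self-marching far cover** with a fixed segment constant `B` and backward reach `γ`:
returns the frontier reached from `e` with `fuel` evaluations budgeted. From the frontier `e` it
evaluates at `u = e + γ`; if the backward piece `[e, u]` is certified it advances by a forward piece
`[u, u + δ]`, otherwise it tries a forward piece from `e` itself; it stops when nothing passes. [folklore] -/
def farMarch (logs : List FI) (S2 B γ : ℚ) : ℕ → ℚ → ℚ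
  | 0, e => e
  | fuel + 1, e =>
    let ev := D.farEval logs B (e + γ)
    if 0 ≤ ev.1 ∧ 0 ≤ ev.1 + γ * ev.2.1 - γ * γ * S2 / 2 then
      match farPick S2 ev.1 ev.2.2 with
      | some δ => farMarch logs S2 B γ fuel (e + γ + δ)
      | none => e + γ
    else
      let ev0 := D.farEval logs B e
      if 0 ≤ ev0.1 then
        match farPick S2 ev0.1 ev0.2.2 with
        | some δ => farMarch logs S2 B γ fuel (e + δ)
        | none => e
      else e

/-- **Far chain**: over increasing breakpoints `e₀ ≤ e₁ ≤ …`, each segment's march (digamma anchor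
`wLoQ` at its own breakpoint with `mwAt` series terms, kernel transform bounded by its decay
beyond the breakpoint) must reach the next breakpoint. [folklore] -/
def farChainOK (logs : List FI) (γ : ℚ) (fuel : ℕ) : List ℚ → Bool
  | e0 :: e1 :: rest =>
    decide (e0 ≤ e1) &&
      decide (e1 ≤ D.farMarch logs (PW.combS2Q D.nodeList D.a logs)
        (D.farB (wLoQ D.prec e0 (D.mwAt e0)) e0) γ fuel e0) &&
      farChainOK logs γ fuel (e1 :: rest)
  | _ => true

end Defs

section Sound

variable {D : PWData}

/-- The comb and its derivative as functions of a real variable. [folklore] -/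
theorem comb_taylor (nodes : Finset ℕ) (a : ℕ → ℚ) (ha : ∀ n ∈ nodes, 0 ≤ a n) (u y : ℝ) :
    ∑ n ∈ nodes, (a n : ℝ) * Real.cos (y * Real.log n) ≤
      ∑ n ∈ nodes, (a n : ℝ) * Real.cos (u * Real.log n) +
        (y - u) * (-∑ n ∈ nodes, (a n : ℝ) * Real.log n * Real.sin (u * Real.log n)) +
        (y - u) ^ 2 / 2 * ∑ n ∈ nodes, (a n : ℝ) * Real.log n ^ 2 := by
  rw [mul_neg, Finset.mul_sum, Finset.mul_sum, ← sub_eq_add_neg, ← Finset.sum_sub_distrib,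
    ← Finset.sum_add_distrib]
  refine Finset.sum_le_sum fun n hn => ?_
  have ha' : (0 : ℝ) ≤ a n := by exact_mod_cast ha n hn
  have h := Real.cos_add_le_taylor (u * Real.log n) ((y - u) * Real.log n)
  have e : u * Real.log n + (y - u) * Real.log n = y * Real.log n := by ring
  rw [e] at h
  nlinarith [mul_le_mul_of_nonneg_left h ha']

/-- A concave quadratic that is `≥ 0` at `0` and at `δ` is `≥ 0` on `[0, δ]`. [folklore] -/
theorem quad_nonneg_of_endpoints {f c S δ t : ℝ} (hS : 0 ≤ S) (h0 : 0 ≤ f)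
    (hδ : 0 ≤ f - δ * c - δ * δ * S / 2) (ht0 : 0 ≤ t) (htδ : t ≤ δ) :
    0 ≤ f - t * c - t * t * S / 2 := by
  rcases eq_or_lt_of_le ht0 with rfl | htpos
  · simpa using h0
  have hδpos : 0 < δ := htpos.trans_le htδ
  -- `f − tc − t²S/2 = (1 − t/δ) f + (t/δ)(f − δc − δ²S/2) + (t/δ)(1 − t/δ) δ² S/2`
  set l : ℝ := t / δ with hl
  have hl0 : 0 ≤ l := div_nonneg ht0 hδpos.le
  have hl1 : l ≤ 1 := (div_le_one hδpos).2 htδ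
  have ht : t = l * δ := by rw [hl]; field_simp
  rw [ht]
  have e : f - l * δ * c - l * δ * (l * δ) * S / 2 =
      (1 - l) * f + l * (f - δ * c - δ * δ * S / 2) + l * (1 - l) * (δ * δ * S / 2) := by ring
  rw [e]
  have : 0 ≤ δ * δ * S / 2 := by positivity
  have h1l : 0 ≤ 1 - l := by linarith
  positivity

end Sound

end PWData


/-! ## Version 2 of the march: stop at the next breakpoint

`farMarch` spends all its fuel even after passing the breakpoint it is meant to reach; the
certificate files use the following variant, which stops as soon as the frontier passes `stop`
(and evaluates the comb once per point). -/

namespace PWData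

section DefsTo

variable (D : PWData)

/-- **The self-marching far cover, stopping at `stop`** (otherwise as `farMarch`): from the frontier
`e` it evaluates at `u = e + γ`; if the backward piece `[e, u]` is certified it advances by a forward
piece `[u, u + δ]`, otherwise it tries a forward piece from `e` itself. [folklore] -/
def farMarchTo (logs : List FI) (S2 B γ stop : ℚ) : ℕ → ℚ → ℚ
  | 0, e => e
  | fuel + 1, e =>
    if stop ≤ e then e else
      let ev := D.farEval logs B (e + γ)
      if 0 ≤ ev.1 ∧ 0 ≤ ev.1 + γ * ev.2.1 - γ * γ * S2 / 2 then
        match farPick S2 ev.1 ev.2.2 with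
        | some δ => farMarchTo logs S2 B γ stop fuel (e + γ + δ)
        | none => e + γ
      else
        let ev0 := D.farEval logs B e
        if 0 ≤ ev0.1 then
          match farPick S2 ev0.1 ev0.2.2 with
          | some δ => farMarchTo logs S2 B γ stop fuel (e + δ)
          | none => e
        else e

/-- **Far chain (version 2)**: over increasing breakpoints `e₀ ≤ e₁ ≤ …`, each segment's march
(digamma anchor `wLoQ` at its own breakpoint, `mwAt` series terms, stopping at the next breakpoint)
must reach the next breakpoint. [folklore] -/
def farChainOKTo (logs : List FI) (γ : ℚ) (fuel : ℕ) : List ℚ → Bool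
  | e0 :: e1 :: rest =>
    decide (e0 ≤ e1) &&
      decide (e1 ≤ D.farMarchTo logs (PW.combS2Q D.nodeList D.a logs)
        (D.farB (wLoQ D.prec e0 (D.mwAt e0)) e0) γ e1 fuel e0) &&
      farChainOKTo logs γ fuel (e1 :: rest)
  | _ => true

end DefsTo

/-- The march with no fuel stays at its frontier (registered anchor of this append). [folklore] -/
theorem farMarchTo_fuel_zero : ∀ (D : PWData) (logs : List FI) (S2 B γ stop e : ℚ), D.farMarchTo logs S2 B γ stop 0 e = e :=
  fun _ _ _ _ _ _ _ => rfl

end PWData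

end Summit.RiemannHypothesis.RiemannHypothesis.Theorems.SignCone

end
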